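import Mathlib
import HarnessLib
import Summits.NavierStokesRegularity.NavierStokesRegularity.Theorems.TypeIQuarterGateScarEnvelopeTypeIFinalTraceBridge

/-!
# TypeIQuarterGate · crux `ScarEnvelopeTypeI` (stmt-NavierStokesRegularity-23843, H3) — TerminalLayerBridge: ns-idea-17's
# slice ⇒ trace lemmas and «slice = trace a.e. where both exist», RE-BASED on the one landed trace vocabulary

LANDING (director-ns #258 = KEY-NS #153 (h); critic of record ns-wall-crit-1 g0, 2026-08-28T19:11:20Z: «ns-idea-17's
two extras (`finalSlice_ae_eq_trace`, `hasZeroTraceOn_iff_finalSlice_orthogonal`) as a short second file IMPORTING [the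
trace-vocabulary module] (re-based, not re-declaring the defs — else duplicate vendored Props under two namespaces)»).
From the crux workfile `Cruxes/ScarEnvelopeTypeI/TerminalLayerBridge.lean` (author ns-idea-17 g4, crux-write commit
8eedaad27d7c, sha16 35415fd9b8952cf0) BY NAME (namespace `…Cruxes.ScarEnvelopeTypeI.ZoomDictionary.TraceBridge`), texts
VERBATIM except: (a) the five §0 «verbatim copies» of the vocabularies are NOT re-declared — `HasFinalSlice` is
`ZoomDictionary.TerminalLayer.HasFinalSlice` and `finalTime`, `slicePairing`, `IsTestOn`, `HasZeroTraceOn`,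
`TraceEssBddOn` are `…FinalTrace.*` (modules `…TypeIQuarterGateScarEnvelopeTypeIFinalTrace` / `…FinalTraceBridge`), opened
below, so every statement reads literally as in the sketch; (b) `finalTime_neBot` is NOT re-declared — it is, statement for statement, the landed
`FinalTrace.finalTime_neBot` (gate rule `dedup.landed`: cite, do not copy); (c) local notation `E3` spelled out.  Content: `tendsto_slicePairing_of_hasFinalSlice` /
`tendsto_slicePairing_finalTime_of_hasFinalSlice` (pairings converge under a uniform bound on `(−δ,0) × S`, `0 ∉ S`),
`norm_finalSlice_le`, `abs_finalSlicePairing_le`, `traceEssBddOn_of_hasFinalSlice_bdd` (THE NAMED BRIDGE, uniform-bound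
form), `tracePairing_eq_of_hasFinalSlice`, `hasZeroTraceOn_iff_finalSlice_orthogonal`, `finalSlice_ae_eq_trace`,
`finalSlice_ae_eq_zero_of_hasZeroTraceOn`.  (The `SlicesLocallyBddOn` forms of the same bridge are ns-idea-18's, in
`…FinalTraceBridge`; the two packagings coexist by name, as filed by their authors.)  Filed
`--supports stmt-NavierStokesRegularity-23843 --as helper` by an idle prover hand (seat ns-ffc-k1 g7) for the LEAD-23843
lineage.  Bridge lemmas only — NOT the crux; NS regularity is NOT proved here; nothing below touches 23843, (E1⁺), H₂ or
any Liouville statement.  The sketch's own header follows.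

# TerminalLayerBridge — ONE trace vocabulary for the two g3 packages on `ScarEnvelopeTypeI`
(stmt-NavierStokesRegularity-23843): the pointwise FINAL SLICE (`TerminalLayer.HasFinalSlice`,
ns-idea-17 g3) versus the distributional FINAL TRACE (`FinalTrace.HasZeroTraceOn` /
`FinalTrace.TraceEssBddOn`, ns-idea-18 g3)

Price V10-P2 = V11-P3 of ns-wall-crit-1 g0 (2026-08-28): «must be bridged by ONE lemma each way on
the regular set (`traceEssBddOn_of_hasFinalSlice_bdd`, and slice = trace a.e. where both exist) so
the two g3 packages compose».  Paid here by ns-idea-17 g4, Mathlib-only and kernel-checked.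

The two sketches live under `Cruxes/ScarEnvelopeTypeI/` and are NOT modules of the farm build graph
(`lean check` on an importing file answers `remote:stale:unbuilt:…FinalTraceSketch`), so the five
definitions below are VERBATIM COPIES of
`…Cruxes.ScarEnvelopeTypeI.ZoomDictionary.TerminalLayer.HasFinalSlice` and
`…Cruxes.ScarEnvelopeTypeI.FinalTrace.{finalTime, slicePairing, IsTestOn, HasZeroTraceOn, TraceEssBddOn}`;
when LEAD 23843 lands both packages in `Theorems/`, every lemma of this file transfers by `Iff.rfl`.

Content (all 0 sorry):
* `finalTime_neBot` — the essential final-time filter `(𝓝[<] 0) ⊓ ae volume` is proper, so limits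
  along it are unique (this is what makes «the» distributional final trace well defined);
* `tendsto_slicePairing_of_hasFinalSlice` — a pointwise final slice `u₀` off the origin plus a local
  sup bound on the test field's support (the regular set / the Type-I envelope off the scar) makes
  every slice pairing converge to `∫ ⟪u₀, φ⟫` along `𝓝[<] 0`, hence along `finalTime`
  (`tendsto_slicePairing_finalTime_of_hasFinalSlice`) — dominated convergence;
* `norm_finalSlice_le` — the final slice inherits the local bound;
* `traceEssBddOn_of_hasFinalSlice_bdd` — THE NAMED BRIDGE (slice side ⇒ trace side on the regular set);
* `tracePairing_eq_of_hasFinalSlice` — «slice = trace where both exist» at pairing level: any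
  distributional final trace value `c` of the pairing with `φ` equals `∫ ⟪u₀, φ⟫`;
* `hasZeroTraceOn_iff_finalSlice_orthogonal` — zero trace on `S` ⟺ the final slice is orthogonal to
  every test field on `S`;
* `finalSlice_ae_eq_trace` — «slice = trace a.e. where both exist»: on an OPEN `S ∌ 0`, any locally
  integrable distributional final trace `v` equals `u₀` a.e. on `S` (Mathlib's fundamental lemma
  `IsOpen.ae_eq_zero_of_integral_contDiff_smul_eq_zero`, applied vector by vector), with the corollary
  `finalSlice_ae_eq_zero_of_hasZeroTraceOn`.

Hygiene: `slicePairing` is a Bochner integral, so measurability of the slices `U s` is an explicit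
hypothesis (in the A–B class it holds); the sign of the bound `M` is never used (outside `tsupport φ`
both sides vanish); `0 ∉ S` is the only geometric hypothesis (the final slice is typed off the origin).
NS regularity is NOT proved here; nothing below touches 23843, (E1⁺), H₂ or any Liouville statement.
-/

set_option linter.dupNamespace false

open MeasureTheory Set Metric Filter Topology
open scoped ENNReal RealInnerProductSpace

namespace Summit.NavierStokesRegularity.NavierStokesRegularity.Cruxes.ScarEnvelopeTypeI.ZoomDictionary.TraceBridge

open Summit.NavierStokesRegularity.NavierStokesRegularity.Cruxes.ScarEnvelopeTypeI.FinalTrace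
  (finalTime slicePairing IsTestOn HasZeroTraceOn TraceEssBddOn finalTime_neBot)
open Summit.NavierStokesRegularity.NavierStokesRegularity.Cruxes.ScarEnvelopeTypeI.ZoomDictionary.TerminalLayer
  (HasFinalSlice)

/-! ## 0. The two vocabularies — NOT re-declared (see the landing note): `TerminalLayer.HasFinalSlice`,
`FinalTrace.finalTime`, `FinalTrace.slicePairing`, `FinalTrace.IsTestOn`, `FinalTrace.HasZeroTraceOn`,
`FinalTrace.TraceEssBddOn` are opened above. -/

/-! ## 1. The essential final-time filter is proper

`finalTime_neBot` (`finalTime` is a proper filter, so limits along it are unique) is, statement for statement, the landed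
`FinalTrace.finalTime_neBot` (`…TypeIQuarterGateScarEnvelopeTypeIFinalTraceBridge`); the gate's `dedup.landed` rule
forbids re-declaring it, so it is opened above and used by that name below. -/

/-! ## 2. Slice side ⇒ trace side -/

section Bridge

variable {U : ℝ → (EuclideanSpace ℝ (Fin 3)) → (EuclideanSpace ℝ (Fin 3))} {u₀ : (EuclideanSpace ℝ (Fin 3)) → (EuclideanSpace ℝ (Fin 3))} {S : Set (EuclideanSpace ℝ (Fin 3))} {M δ : ℝ} {φ : (EuclideanSpace ℝ (Fin 3)) → (EuclideanSpace ℝ (Fin 3))}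

/-- Outside the topological support a test field vanishes. -/
private theorem test_eq_zero_of_not_mem {x : (EuclideanSpace ℝ (Fin 3))} (hx : x ∉ tsupport φ) : φ x = 0 := by
  by_contra hne
  exact hx (subset_tsupport φ (Function.mem_support.2 hne))

/-- **Pairings converge (along `𝓝[<] 0`).**  A pointwise final slice off the origin and a sup bound
`‖U(s,x)‖ ≤ M` for `s ∈ (−δ, 0)`, `x ∈ S` (with `0 ∉ S`, slices measurable) give
`∫ ⟪U(s), φ⟫ → ∫ ⟪u₀, φ⟫` as `s → 0⁻` for every test field `φ` on `S` — dominated convergence with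
the majorant `M‖φ‖`. -/
theorem tendsto_slicePairing_of_hasFinalSlice (hU : HasFinalSlice U u₀) (h0 : (0 : (EuclideanSpace ℝ (Fin 3))) ∉ S)
    (hmeas : ∀ s : ℝ, AEStronglyMeasurable (U s) volume) (hδ : 0 < δ)
    (hbd : ∀ s ∈ Ioo (-δ) 0, ∀ x ∈ S, ‖U s x‖ ≤ M) (hφ : IsTestOn S φ) :
    Tendsto (slicePairing U φ) (𝓝[<] (0 : ℝ)) (𝓝 (∫ x, ⟪u₀ x, φ x⟫)) := by
  have hI : Ioo (-δ) 0 ∈ 𝓝[<] (0 : ℝ) := Ioo_mem_nhdsLT (by linarith)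
  refine tendsto_integral_filter_of_dominated_convergence (fun x => M * ‖φ x‖) ?_ ?_ ?_ ?_
  · exact Eventually.of_forall fun s => (hmeas s).inner hφ.1.aestronglyMeasurable
  · filter_upwards [hI] with s hs
    refine Eventually.of_forall fun x => ?_
    by_cases hx : x ∈ tsupport φ
    · have hxS : x ∈ S := hφ.2.2 hx
      calc ‖⟪U s x, φ x⟫‖ ≤ ‖U s x‖ * ‖φ x‖ := norm_inner_le_norm _ _
        _ ≤ M * ‖φ x‖ := mul_le_mul_of_nonneg_right (hbd s hs x hxS) (norm_nonneg _)
    · simp [test_eq_zero_of_not_mem hx]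
  · exact ((hφ.1.integrable_of_hasCompactSupport hφ.2.1).norm).const_mul M
  · refine Eventually.of_forall fun x => ?_
    by_cases hx : x ∈ tsupport φ
    · have hx0 : x ≠ 0 := fun h => h0 (h ▸ hφ.2.2 hx)
      exact (hU x hx0).inner tendsto_const_nhds
    · simp [test_eq_zero_of_not_mem hx]

/-- The same convergence along the essential final-time filter `finalTime ≤ 𝓝[<] 0`. -/
theorem tendsto_slicePairing_finalTime_of_hasFinalSlice (hU : HasFinalSlice U u₀) (h0 : (0 : (EuclideanSpace ℝ (Fin 3))) ∉ S)
    (hmeas : ∀ s : ℝ, AEStronglyMeasurable (U s) volume) (hδ : 0 < δ)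
    (hbd : ∀ s ∈ Ioo (-δ) 0, ∀ x ∈ S, ‖U s x‖ ≤ M) (hφ : IsTestOn S φ) :
    Tendsto (slicePairing U φ) finalTime (𝓝 (∫ x, ⟪u₀ x, φ x⟫)) :=
  (tendsto_slicePairing_of_hasFinalSlice hU h0 hmeas hδ hbd hφ).mono_left inf_le_left

/-- The final slice inherits the local bound: `‖u₀ x‖ ≤ M` on `S`. -/
theorem norm_finalSlice_le (hU : HasFinalSlice U u₀) (h0 : (0 : (EuclideanSpace ℝ (Fin 3))) ∉ S) (hδ : 0 < δ)
    (hbd : ∀ s ∈ Ioo (-δ) 0, ∀ x ∈ S, ‖U s x‖ ≤ M) {x : (EuclideanSpace ℝ (Fin 3))} (hx : x ∈ S) : ‖u₀ x‖ ≤ M := by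
  have hx0 : x ≠ 0 := fun h => h0 (h ▸ hx)
  have hI : Ioo (-δ) 0 ∈ 𝓝[<] (0 : ℝ) := Ioo_mem_nhdsLT (by linarith)
  refine le_of_tendsto (hU x hx0).norm ?_
  filter_upwards [hI] with s hs
  exact hbd s hs x hx

/-- The limit pairing is bounded by `M‖φ‖_{L¹}`. -/
theorem abs_finalSlicePairing_le (hU : HasFinalSlice U u₀) (h0 : (0 : (EuclideanSpace ℝ (Fin 3))) ∉ S) (hδ : 0 < δ)
    (hbd : ∀ s ∈ Ioo (-δ) 0, ∀ x ∈ S, ‖U s x‖ ≤ M) (hφ : IsTestOn S φ) :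
    |∫ x, ⟪u₀ x, φ x⟫| ≤ M * ∫ x, ‖φ x‖ := by
  have hbound : ∀ᵐ x ∂(volume : Measure (EuclideanSpace ℝ (Fin 3))), ‖⟪u₀ x, φ x⟫‖ ≤ M * ‖φ x‖ := by
    refine Eventually.of_forall fun x => ?_
    by_cases hx : x ∈ tsupport φ
    · have hxS : x ∈ S := hφ.2.2 hx
      calc ‖⟪u₀ x, φ x⟫‖ ≤ ‖u₀ x‖ * ‖φ x‖ := norm_inner_le_norm _ _
        _ ≤ M * ‖φ x‖ :=
          mul_le_mul_of_nonneg_right (norm_finalSlice_le hU h0 hδ hbd hxS) (norm_nonneg _)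
    · simp [test_eq_zero_of_not_mem hx]
  have hint : Integrable (fun x => M * ‖φ x‖) (volume : Measure (EuclideanSpace ℝ (Fin 3))) :=
    ((hφ.1.integrable_of_hasCompactSupport hφ.2.1).norm).const_mul M
  have hle := norm_integral_le_of_norm_le hint hbound
  rw [integral_const_mul] at hle
  calc |∫ x, ⟪u₀ x, φ x⟫| = ‖∫ x, ⟪u₀ x, φ x⟫‖ := (Real.norm_eq_abs _).symm
    _ ≤ M * ∫ x, ‖φ x‖ := hle

/-- **THE NAMED BRIDGE (V10-P2 / V11-P3): slice side ⇒ trace side on the regular set.**  If `U` has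
a pointwise final slice off the origin and is bounded by `M` on `(−δ,0) × S` (`0 ∉ S`; e.g. `S` a
ball of final-time regular points, or any set at positive distance from the scar under the Type-I
envelope `‖U‖ ≤ A/‖x‖`), then the distributional final trace of `U` is essentially bounded by `M`
on `S` in the sense of `FinalTrace.TraceEssBddOn`. -/
theorem traceEssBddOn_of_hasFinalSlice_bdd (hU : HasFinalSlice U u₀) (h0 : (0 : (EuclideanSpace ℝ (Fin 3))) ∉ S)
    (hmeas : ∀ s : ℝ, AEStronglyMeasurable (U s) volume) (hδ : 0 < δ)
    (hbd : ∀ s ∈ Ioo (-δ) 0, ∀ x ∈ S, ‖U s x‖ ≤ M) : TraceEssBddOn U S M := by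
  intro φ hφ ε hε
  have hlim := tendsto_slicePairing_finalTime_of_hasFinalSlice hU h0 hmeas hδ hbd hφ
  have hL := abs_finalSlicePairing_le hU h0 hδ hbd hφ
  have hev : ∀ᶠ s in finalTime, dist (slicePairing U φ s) (∫ x, ⟪u₀ x, φ x⟫) < ε :=
    (Metric.tendsto_nhds.1 hlim) ε hε
  filter_upwards [hev] with s hs
  rw [Real.dist_eq] at hs
  have h1 := abs_sub_abs_le_abs_sub (slicePairing U φ s) (∫ x, ⟪u₀ x, φ x⟫)
  linarith

/-! ## 3. Slice = trace where both exist (pairing level) -/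

/-- **Uniqueness.**  Under the same hypotheses, if the pairing with a test field `φ` on `S` has ANY
essential final limit `c` (a «distributional final trace» value), then `c = ∫ ⟪u₀, φ⟫`: the
distributional trace and the pointwise final slice agree on every test field on `S`. -/
theorem tracePairing_eq_of_hasFinalSlice (hU : HasFinalSlice U u₀) (h0 : (0 : (EuclideanSpace ℝ (Fin 3))) ∉ S)
    (hmeas : ∀ s : ℝ, AEStronglyMeasurable (U s) volume) (hδ : 0 < δ)
    (hbd : ∀ s ∈ Ioo (-δ) 0, ∀ x ∈ S, ‖U s x‖ ≤ M) (hφ : IsTestOn S φ) {c : ℝ}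
    (hc : Tendsto (slicePairing U φ) finalTime (𝓝 c)) : c = ∫ x, ⟪u₀ x, φ x⟫ :=
  haveI := finalTime_neBot
  tendsto_nhds_unique hc (tendsto_slicePairing_finalTime_of_hasFinalSlice hU h0 hmeas hδ hbd hφ)

/-- **Zero trace ⟺ orthogonal final slice.**  Under the same hypotheses, `U` has zero final trace
on `S` iff its final slice is orthogonal to every test field on `S` (equivalently, by the
fundamental lemma of the calculus of variations applied componentwise, `u₀ = 0` a.e. on `S` when
`S` is open). -/
theorem hasZeroTraceOn_iff_finalSlice_orthogonal (hU : HasFinalSlice U u₀) (h0 : (0 : (EuclideanSpace ℝ (Fin 3))) ∉ S)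
    (hmeas : ∀ s : ℝ, AEStronglyMeasurable (U s) volume) (hδ : 0 < δ)
    (hbd : ∀ s ∈ Ioo (-δ) 0, ∀ x ∈ S, ‖U s x‖ ≤ M) :
    HasZeroTraceOn U S ↔ ∀ φ : (EuclideanSpace ℝ (Fin 3)) → (EuclideanSpace ℝ (Fin 3)), IsTestOn S φ → ∫ x, ⟪u₀ x, φ x⟫ = 0 := by
  constructor
  · intro h φ hφ
    exact (tracePairing_eq_of_hasFinalSlice hU h0 hmeas hδ hbd hφ (h φ hφ)).symm
  · intro h φ hφ
    have := tendsto_slicePairing_finalTime_of_hasFinalSlice hU h0 hmeas hδ hbd hφ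
    rwa [h φ hφ] at this

/-- Scalar bump times a fixed vector is a test field on `S`. -/
private theorem isTestOn_smul_const {g : (EuclideanSpace ℝ (Fin 3)) → ℝ} (hg : Continuous g) (hgc : HasCompactSupport g)
    (hgS : tsupport g ⊆ S) (e : (EuclideanSpace ℝ (Fin 3))) : IsTestOn S (fun x => g x • e) :=
  ⟨hg.smul continuous_const, hgc.mono (Function.support_smul_subset_left g fun _ => e),
    (tsupport_smul_subset_left g fun _ => e).trans hgS⟩

/-- **Slice = trace a.e. where both exist (the fundamental-lemma upgrade).**  If, on an open set
`S ∌ 0` where `U` is locally bounded near the final time, the pairings have a distributional final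
trace represented by a locally integrable field `v` (`∫⟪U(s), φ⟫ → ∫⟪v, φ⟫` essentially as
`s → 0⁻` for every test field on `S`), then `v = u₀` a.e. on `S`.  (Local integrability of `u₀`
holds in the A–B class from the envelope `‖u₀‖ ≤ A/‖x‖`; it is an explicit hypothesis here.) -/
theorem finalSlice_ae_eq_trace (hS : IsOpen S) (hU : HasFinalSlice U u₀) (h0 : (0 : (EuclideanSpace ℝ (Fin 3))) ∉ S)
    (hmeas : ∀ s : ℝ, AEStronglyMeasurable (U s) volume) (hδ : 0 < δ)
    (hbd : ∀ s ∈ Ioo (-δ) 0, ∀ x ∈ S, ‖U s x‖ ≤ M) (hu₀ : LocallyIntegrable u₀ volume)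
    {v : (EuclideanSpace ℝ (Fin 3)) → (EuclideanSpace ℝ (Fin 3))} (hv : LocallyIntegrable v volume)
    (htr : ∀ φ : (EuclideanSpace ℝ (Fin 3)) → (EuclideanSpace ℝ (Fin 3)), IsTestOn S φ →
      Tendsto (slicePairing U φ) finalTime (𝓝 (∫ x, ⟪v x, φ x⟫))) :
    ∀ᵐ x ∂(volume : Measure (EuclideanSpace ℝ (Fin 3))), x ∈ S → v x = u₀ x := by
  -- every test pairing of `v` equals that of `u₀`
  have hpair : ∀ φ : (EuclideanSpace ℝ (Fin 3)) → (EuclideanSpace ℝ (Fin 3)), IsTestOn S φ → ∫ x, ⟪v x, φ x⟫ = ∫ x, ⟪u₀ x, φ x⟫ := fun φ hφ =>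
    tracePairing_eq_of_hasFinalSlice hU h0 hmeas hδ hbd hφ (htr φ hφ)
  -- hence every scalar-bump moment of `v - u₀` vanishes, vector by vector
  have hmom : ∀ g : (EuclideanSpace ℝ (Fin 3)) → ℝ, ContDiff ℝ (⊤ : ℕ∞) g → HasCompactSupport g → tsupport g ⊆ S →
      ∫ x, g x • (v - u₀) x = 0 := by
    intro g hg hgc hgS
    have hgv : Integrable (fun x => g x • v x) :=
      hv.integrable_smul_left_of_hasCompactSupport hg.continuous hgc
    have hgu : Integrable (fun x => g x • u₀ x) :=
      hu₀.integrable_smul_left_of_hasCompactSupport hg.continuous hgc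
    have hvec : ∫ x, g x • v x = ∫ x, g x • u₀ x := by
      refine ext_inner_left ℝ fun e => ?_
      have h1 := hpair (fun x => g x • e) (isTestOn_smul_const hg.continuous hgc hgS e)
      have hl : ∫ x, ⟪v x, g x • e⟫ = ⟪e, ∫ x, g x • v x⟫ := by
        rw [← integral_inner hgv e]
        refine integral_congr_ae (Eventually.of_forall fun x => ?_)
        simp only [real_inner_smul_right, real_inner_comm]
      have hr : ∫ x, ⟪u₀ x, g x • e⟫ = ⟪e, ∫ x, g x • u₀ x⟫ := by
        rw [← integral_inner hgu e]
        refine integral_congr_ae (Eventually.of_forall fun x => ?_)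
        simp only [real_inner_smul_right, real_inner_comm]
      rw [← hl, ← hr, h1]
    have : (fun x => g x • (v - u₀) x) = fun x => g x • v x - g x • u₀ x := by
      funext x; rw [Pi.sub_apply, smul_sub]
    rw [this, integral_sub hgv hgu, hvec, sub_self]
  have hz := hS.ae_eq_zero_of_integral_contDiff_smul_eq_zero
    ((hv.sub hu₀).locallyIntegrableOn S) hmom
  filter_upwards [hz] with x hx hxS
  exact sub_eq_zero.1 (by simpa [Pi.sub_apply] using hx hxS)

/-- In particular: zero final trace on such an `S` forces the final slice to vanish a.e. on `S`. -/
theorem finalSlice_ae_eq_zero_of_hasZeroTraceOn (hS : IsOpen S) (hU : HasFinalSlice U u₀)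
    (h0 : (0 : (EuclideanSpace ℝ (Fin 3))) ∉ S) (hmeas : ∀ s : ℝ, AEStronglyMeasurable (U s) volume) (hδ : 0 < δ)
    (hbd : ∀ s ∈ Ioo (-δ) 0, ∀ x ∈ S, ‖U s x‖ ≤ M) (hu₀ : LocallyIntegrable u₀ volume)
    (hZ : HasZeroTraceOn U S) : ∀ᵐ x ∂(volume : Measure (EuclideanSpace ℝ (Fin 3))), x ∈ S → u₀ x = 0 := by
  have h := finalSlice_ae_eq_trace hS hU h0 hmeas hδ hbd hu₀ (v := fun _ => (0 : (EuclideanSpace ℝ (Fin 3))))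
    (locallyIntegrable_const (0 : (EuclideanSpace ℝ (Fin 3)))) (fun φ hφ => by simpa using hZ φ hφ)
  filter_upwards [h] with x hx hxS
  exact (hx hxS).symm

end Bridge

/-! ## 4. Designed checks (the hypotheses are not vacuous; the bound's sign is never used) -/

/-- A static field is its own final slice. -/
example (v : (EuclideanSpace ℝ (Fin 3)) → (EuclideanSpace ℝ (Fin 3))) : HasFinalSlice (fun _ => v) v := fun _ _ => tendsto_const_nhds

/-- The zero field has zero trace everywhere (no hypotheses needed). -/
example (S : Set (EuclideanSpace ℝ (Fin 3))) : HasZeroTraceOn (fun _ _ => (0 : (EuclideanSpace ℝ (Fin 3)))) S := by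
  intro φ _
  have h : slicePairing (fun _ _ => (0 : (EuclideanSpace ℝ (Fin 3)))) φ = fun _ => 0 := by
    funext s
    simp [slicePairing]
  rw [h]
  exact tendsto_const_nhds

end Summit.NavierStokesRegularity.NavierStokesRegularity.Cruxes.ScarEnvelopeTypeI.ZoomDictionary.TraceBridge
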